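import Summits.Ventures.HSemireg.WeilFrameRealCarrierAllDegrees
import Summits.Ventures.HSemireg.Mod4LeadingTermSpectrum
import Summits.Ventures.HSemireg.Mod4PointSpectrum

/-!
# Venture HSemireg — UPPER SIDE DEGREES of the POINT row and of the CARRIER ∕ DESIGN rows on the real carrier, every `n`
# (palindromy `R_{2n−k'} = R_{k'}` of TABLE R through FILE 15's dual theorem: `3C(2n,k') − 2C(n,k')` resp. `(k'+3)C(2n,k') − 2(k'+1)C(n,k')`)

HONEST FRAMING. Part of the Lean index of the computation cell `pub-hsemireg` (seat w3-mod4-1 gen 13, W3 SPECIAL FIBRES;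
MOD4-OFFSPLIT §8 TABLE R rows «w + s·pt» and the carrier ∕ design rows, upper halves: `n = 2, 3` computed ×2, `n = 4` kit ×1; §13.21–13.23).
The tree's real carriers and the Literature's Weil-type layer ONLY: no semiregularity map, no Ext group, no `∫`; nothing here says
that HC / HC_CM / HC_AV holds; nothing here is a claim about any explicit variety or cycle; no Literature fact is declared; NO
definition is introduced. Imports: FILE 15 `WeilFrameRealCarrierAllDegrees` (the dual side-degree theorem) + the pure matrix files
`Mod4LeadingTermSpectrum` (FILE 32) and `Mod4PointSpectrum` (FILE 30).

WHAT IS PROVED, for `A : AbelianVariety ℂ` of dimension `2n`, `φ ≫ φ = -(d • 𝟙 A)`, `d ≥ 1`, `P, Q` the `±i√d`-eigenspaces,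
`dim (P ⊓ H^{1,0}) = n`, `h` `K`-symmetric of type `(1,1)` with `ĥ^{2n} ≠ 0`, non-zero `c± ∈ E±`, an upper degree `k` with
`k + k' = 2n`, `1 ≤ k' ≤ n − 1`:
* **`finrank_S_leading_deg_dual`** — for ANY `q` with `q_m = 0` (`1 ≤ m ≤ n − 1`) and `q_n ≠ 0`:
  `dim S_k(x) + 2(k'+1)·C(n,k') = (k'+3)·C(2n,k')` (`r_{k'} = k' + 1`, `Mod4.hankel1_rank_leading`, in FILE 15's
  `finrank_S_weilType_deg_dual`) — with FILE 33 the carrier ∕ design rows are kernel in EVERY side degree;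
* **`finrank_S_point_deg_dual`** — for `x = (B/(2n)!) ĥ^{2n} + ĉ₊ + ĉ₋`, `B ≠ 0`: `dim S_k(x) + 2C(n,k') = 3C(2n,k')`
  (`Mod4.hankel1_rank_point`) — with FILE 31 the point row is kernel in every degree.
CHECK: `n = 3`, `k = 4` (`k' = 2`): carrier rows `5·15 − 6·3 = 57`, point row `45 − 6 = 39`; `k = 5`: `12`, `12` — as printed.
Everything PROVED, 0 sorry.
References: [BuchweitzFlenner2008HH] Prop. 6.4.4; [vanGeemen1994HodgeAV] 4.9, Lemma 5.2; [BourbakiAlgebre1a3] Ch. III §8, §11 no. 9.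
-/

noncomputable section

open CliffordAlgebra (contractLeft)
open ExteriorAlgebra (ι)
open Module CategoryTheory
open Literature.AlgebraicGeometry.Motives Literature.AlgebraicGeometry.HodgeTheory
open Literature.AlgebraicTopology.SingularHomology

namespace Summit.Ventures.HSemireg.WeilFrame

open Summit.Ventures.HSemireg.WedgeBridge Summit.Ventures.HSemireg.WeilCarrier Summit.Ventures.HSemireg.Mod4Carrier
open Summit.Ventures.HSemireg.Wedge.Hankel

section RealCarrier

variable {A : AbelianVariety ℂ}

/-- **carrier ∕ design rows, UPPER side degrees on the real carrier** (`k + k' = 2n`, `1 ≤ k' ≤ n − 1`): for `q_m = 0`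
(`1 ≤ m ≤ n − 1`), `q_n ≠ 0`: `dim S_k(x) + 2(k'+1)·C(n,k') = (k'+3)·C(2n,k')`. [cite: BuchweitzFlenner2008HH, Prop. 6.4.4]
[cite: vanGeemen1994HodgeAV, 4.9 and Lemma 5.2] -/
theorem finrank_S_leading_deg_dual (hA : IsSmoothProjective A.dim A.X) {n d : ℕ} (hdim : A.dim = n + n) (hd : 0 < d)
    {φ : A ⟶ A} (hφ : φ ≫ φ = -(d • 𝟙 A)) {P Q : Submodule ℂ (complexBetti A.X 1)}
    (hP : P = Module.End.eigenspace (complexBetti.map φ.hom.hom.hom 1).hom (Complex.I * (Real.sqrt d : ℂ)))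
    (hQ : Q = Module.End.eigenspace (complexBetti.map φ.hom.hom.hom 1).hom (-(Complex.I * (Real.sqrt d : ℂ))))
    (hp : finrank ℂ ↥(P ⊓ hodgeOneZero hA) = n) {h : complexBetti A.X 2}
    (hh : complexBetti.map φ.hom.hom.hom 2 h = (d : ℂ) • h) (h11 : IsOfHodgeType A.dim A.X 2 1 1 h)
    (hvol : ((⋀[ℂ]^2 (complexBetti A.X 1)).subtype ((abelianVarietyCohomologyExteriorH1_holds.equiv A 2).symm h)) ^ (n + n) ≠ 0)
    {cP : complexBetti A.X (2 * n)} (hcP : cP ∈ weilClassesPlus A φ n d) (hcP0 : cP ≠ 0)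
    {cQ : complexBetti A.X (2 * n)} (hcQ : cQ ∈ weilClassesMinus A φ n d) (hcQ0 : cQ ≠ 0)
    {q : ℕ → ℂ} (hq0 : ∀ m, 1 ≤ m → m < n → q m = 0) (hqn : q n ≠ 0) {k k' : ℕ} (hk1 : 1 ≤ k') (hkn : k' + 1 ≤ n)
    (hkk : k + k' = n + n) :
    finrank ℂ ↥(S ℂ (hodgeZeroOne hA) k
        ((∑ m ∈ Finset.range (n + n + 1), (q m * ((m.factorial : ℕ) : ℂ)⁻¹) •
            ((⋀[ℂ]^2 (complexBetti A.X 1)).subtype ((abelianVarietyCohomologyExteriorH1_holds.equiv A 2).symm h)) ^ m) +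
          (⋀[ℂ]^(2 * n) (complexBetti A.X 1)).subtype ((abelianVarietyCohomologyExteriorH1_holds.equiv A (2 * n)).symm cP) +
          (⋀[ℂ]^(2 * n) (complexBetti A.X 1)).subtype ((abelianVarietyCohomologyExteriorH1_holds.equiv A (2 * n)).symm cQ))) +
        2 * (k' + 1) * n.choose k' = (k' + 3) * (n + n).choose k' := by
  haveI : Module.Finite ℂ (complexBetti A.X 1) := abelianVarietyCohomologyExteriorH1_holds.finite_one A
  have h := finrank_S_weilType_deg_dual hA hdim hd hφ hP hQ hp hh h11 hvol hcP hcP0 hcQ hcQ0 q hk1 hkn hkk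
  rw [Mod4.hankel1_rank_leading hkn hq0 hqn] at h
  have e1 : (n.choose k' + n.choose k') * (k' + 1) = 2 * (k' + 1) * n.choose k' := by ring
  have e2 : (n + n).choose k' + (n + n).choose k' + (n + n).choose k' * (k' + 1) = (k' + 3) * (n + n).choose k' := by ring
  omega

/-- **the point row, UPPER side degrees on the real carrier** (`k + k' = 2n`, `1 ≤ k' ≤ n − 1`): for
`x = (B/(2n)!) ĥ^{2n} + ĉ₊ + ĉ₋`, `B ≠ 0`: `dim S_k(x) + 2C(n,k') = 3C(2n,k')`. [cite: BuchweitzFlenner2008HH, Prop. 6.4.4] -/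
theorem finrank_S_point_deg_dual (hA : IsSmoothProjective A.dim A.X) {n d : ℕ} (hdim : A.dim = n + n) (hd : 0 < d)
    {φ : A ⟶ A} (hφ : φ ≫ φ = -(d • 𝟙 A)) {P Q : Submodule ℂ (complexBetti A.X 1)}
    (hP : P = Module.End.eigenspace (complexBetti.map φ.hom.hom.hom 1).hom (Complex.I * (Real.sqrt d : ℂ)))
    (hQ : Q = Module.End.eigenspace (complexBetti.map φ.hom.hom.hom 1).hom (-(Complex.I * (Real.sqrt d : ℂ))))
    (hp : finrank ℂ ↥(P ⊓ hodgeOneZero hA) = n) {h : complexBetti A.X 2}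
    (hh : complexBetti.map φ.hom.hom.hom 2 h = (d : ℂ) • h) (h11 : IsOfHodgeType A.dim A.X 2 1 1 h)
    (hvol : ((⋀[ℂ]^2 (complexBetti A.X 1)).subtype ((abelianVarietyCohomologyExteriorH1_holds.equiv A 2).symm h)) ^ (n + n) ≠ 0)
    {cP : complexBetti A.X (2 * n)} (hcP : cP ∈ weilClassesPlus A φ n d) (hcP0 : cP ≠ 0)
    {cQ : complexBetti A.X (2 * n)} (hcQ : cQ ∈ weilClassesMinus A φ n d) (hcQ0 : cQ ≠ 0)
    {Bₛ : ℂ} (hBs : Bₛ ≠ 0) {k k' : ℕ} (hk1 : 1 ≤ k') (hkn : k' + 1 ≤ n) (hkk : k + k' = n + n) :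
    finrank ℂ ↥(S ℂ (hodgeZeroOne hA) k
        ((Bₛ * (((n + n).factorial : ℕ) : ℂ)⁻¹) •
            ((⋀[ℂ]^2 (complexBetti A.X 1)).subtype ((abelianVarietyCohomologyExteriorH1_holds.equiv A 2).symm h)) ^ (n + n) +
          (⋀[ℂ]^(2 * n) (complexBetti A.X 1)).subtype ((abelianVarietyCohomologyExteriorH1_holds.equiv A (2 * n)).symm cP) +
          (⋀[ℂ]^(2 * n) (complexBetti A.X 1)).subtype ((abelianVarietyCohomologyExteriorH1_holds.equiv A (2 * n)).symm cQ))) +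
        2 * n.choose k' = 3 * (n + n).choose k' := by
  haveI : Module.Finite ℂ (complexBetti A.X 1) := abelianVarietyCohomologyExteriorH1_holds.finite_one A
  have hmain := finrank_S_weilType_deg_dual hA hdim hd hφ hP hQ hp hh h11 hvol hcP hcP0 hcQ hcQ0
    (fun m => if m = n + n then Bₛ else 0) hk1 hkn hkk
  -- the h-part of the point sequence is `(B/(2n)!)·ĥ^{2n}` (FILE 31's `sum_pointSeq_smul_pow`, re-derived inline to keep the imports minimal)
  have e : ∑ m ∈ Finset.range (n + n + 1), ((fun m => if m = n + n then Bₛ else 0) m * ((m.factorial : ℕ) : ℂ)⁻¹) •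
        ((⋀[ℂ]^2 (complexBetti A.X 1)).subtype ((abelianVarietyCohomologyExteriorH1_holds.equiv A 2).symm h)) ^ m =
      (Bₛ * (((n + n).factorial : ℕ) : ℂ)⁻¹) •
        ((⋀[ℂ]^2 (complexBetti A.X 1)).subtype ((abelianVarietyCohomologyExteriorH1_holds.equiv A 2).symm h)) ^ (n + n) := by
    rw [Finset.sum_eq_single (n + n)]
    · simp only [if_true]
    · intro m _ hm
      simp only [if_neg hm, zero_mul, zero_smul]
    · intro hnot
      exact absurd (Finset.self_mem_range_succ (n + n)) hnot
  rw [e, Mod4.hankel1_rank_point (by omega) hBs] at hmain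
  omega

end RealCarrier

end Summit.Ventures.HSemireg.WeilFrame

end
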